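import Mathlib
import Literature.MathematicalPhysics.QuantumFieldTheory.MirrorRPHalfPlaneContinuation
import Literature.MeasureTheory.Integral.WidderLaplaceRepresentation
import HarnessLib

/-!
# Reflection positivity in one mirror ⇒ the normal slices are Laplace transforms of measures

Measure form of `MirrorRPHalfPlaneContinuation.lean` (which continues the normal slices of a mirror-RP kernel
holomorphically, measure-free).  Let `E` be a real inner product space, `n ≠ 0`, and `K : E → ℝ` reflection positive for
the mirror `n^⊥` (`IsMirrorRPKernel n K`), continuous off `0` and bounded on every closed half-space `{⟪x, n̂⟫ ≥ t₀}`,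
`t₀ > 0`.

* `IsMirrorRPKernel.semigroupPosDef_smeared` — for every finite transverse configuration `y : ι → n^⊥` and real
  weights `c`, the SMEARED NORMAL SLICE `t ↦ ∑_{a,b} c_a c_b K(t n̂ + (y_a − y_b))` is positive definite on the semigroup
  `((0,∞),+)` (the RP Gram matrix of the configuration `{sᵢ n̂ + y_a}`; no evenness needed);
* `IsMirrorRPKernel.exists_measure_laplace_smeared` — hence (Widder's theorem in measure form,
  `exists_measure_laplace_eq_of_semigroupPosDef`) it is the Laplace transform of ONE positive measure on `[0,∞)`, finite
  on every `e^{-t·}`, `t > 0` (possibly infinite: RP kernels of quantum fields blow up at the origin) — the `E`-marginals,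
  smeared by discrete transverse measures, of the Laplace–Fourier (Källén–Lehmann type) representation of the two-point
  function [cite: GlimmJaffeQP1987, §6.2];
* `IsMirrorRPKernel.exists_measure_laplace_polarised`, `IsMirrorRPKernel.exists_measures_laplace_slice` — for `K` moreover
  even and mirror invariant and `y ⊥ n`: `K(t n̂) ± K(t n̂ + y)` are Laplace transforms of positive measures, so every single
  slice `t ↦ K(t n̂ + y)` is HALF THE DIFFERENCE of two Laplace transforms of positive measures, and the axis function
  `t ↦ K(t n̂)` is a Laplace transform of a positive measure (`exists_measure_laplace_axis`).

THEOREMS ONLY (no definitions); Mathlib + tree; no `sorry`; standard axioms.  Motivation in the tree: step S1 of the plan of record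
for stub T2′ of LINE g17-A on crux ⟨stmt-QuantumFields-23125⟩ (`F4SubCurvatureDoor.RationalToGeneral`): the Laplace–Fourier measure of
a reflection-positive kernel; this file supplies its `t`-structure, the transverse (`Bochner`) assembly is not done here.
[cite: GlimmJaffeQP1987, §6.1 Thm. 6.1.3] [cite: Widder1941, Ch. VI Thm. 21]
-/

noncomputable section

open MeasureTheory Set Filter Topology
open scoped InnerProductSpace BigOperators

namespace Literature.MathematicalPhysics.QuantumFieldTheory

open Literature.Analysis.SpecialFunctions Literature.MeasureTheory.Integral

variable {E : Type*} [NormedAddCommGroup E] [InnerProductSpace ℝ E]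

/-! ### Smeared normal slices are positive definite on `(0,∞)` -/

/-- **Smeared normal slices of a mirror-RP kernel are positive definite on the semigroup `((0,∞),+)`**: for a finite
transverse configuration `y_a ⊥ n` and real weights `c_a`, `G(t) = ∑_{a,b} c_a c_b K(t n̂ + (y_a − y_b))` satisfies
`∑ᵢⱼ dᵢ dⱼ G(sᵢ + sⱼ) ≥ 0` (`sᵢ > 0`) — reflection positivity on the configuration `{sᵢ n̂ + y_a}` with weights `dᵢ c_a`.
[cite: GlimmJaffeQP1987, §6.1 Thm. 6.1.3] -/
theorem IsMirrorRPKernel.semigroupPosDef_smeared {K : E → ℝ} {n : E} (hn : n ≠ 0) (hRP : IsMirrorRPKernel n K)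
    {ι : Type*} [Fintype ι] (y : ι → E) (hy : ∀ a, ⟪y a, n⟫_ℝ = 0) (c : ι → ℝ) :
    ∀ (m : ℕ) (s d : Fin m → ℝ), (∀ k₀, 0 < s k₀) →
      0 ≤ ∑ i₁, ∑ i₂, d i₁ * d i₂ *
        (∑ a, ∑ b, c a * c b * K ((s i₁ + s i₂) • ‖n‖⁻¹ • n + (y a - y b))) := by
  intro m s d hs
  -- the configuration `(i, a) ↦ sᵢ n̂ + y_a` with weights `dᵢ c_a`
  let p : Fin m × ι → E := fun q => s q.1 • ‖n‖⁻¹ • n + y q.2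
  let w : Fin m × ι → ℝ := fun q => d q.1 * c q.2
  have hp : ∀ q, 0 < ⟪p q, n⟫_ℝ := by
    intro q
    show 0 < ⟪s q.1 • ‖n‖⁻¹ • n + y q.2, n⟫_ℝ
    rw [inner_add_left, real_inner_smul_left, inner_unitNormal_normal n hn, hy, add_zero]
    exact mul_pos (hs q.1) (norm_pos_iff.mpr hn)
  have h0 := hRP.sum_nonneg p w hp
  have hterm : ∀ q q' : Fin m × ι, K (p q - (ℝ ∙ n)ᗮ.reflection (p q')) =
      K ((s q.1 + s q'.1) • ‖n‖⁻¹ • n + (y q.2 - y q'.2)) := by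
    intro q q'
    show K (s q.1 • ‖n‖⁻¹ • n + y q.2 - (ℝ ∙ n)ᗮ.reflection (s q'.1 • ‖n‖⁻¹ • n + y q'.2)) = _
    rw [map_add, reflection_smul_unitNormal, mirrorReflection_of_inner_eq_zero (hy q'.2)]
    congr 1
    rw [add_smul]
    abel
  have hexp : ∑ q, ∑ q', w q * w q' * K (p q - (ℝ ∙ n)ᗮ.reflection (p q')) =
      ∑ i₁, ∑ i₂, d i₁ * d i₂ * (∑ a, ∑ b, c a * c b * K ((s i₁ + s i₂) • ‖n‖⁻¹ • n + (y a - y b))) := by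
    simp only [hterm]
    rw [Fintype.sum_prod_type]
    refine Finset.sum_congr rfl fun i₁ _ => ?_
    rw [Finset.sum_comm, Fintype.sum_prod_type]
    refine (Finset.sum_congr rfl fun i₂ _ => ?_)
    rw [Finset.mul_sum, Finset.sum_comm]
    refine Finset.sum_congr rfl fun a _ => ?_
    rw [Finset.mul_sum]
    refine Finset.sum_congr rfl fun b _ => ?_
    ring
  rw [hexp] at h0
  exact h0

/-- The smeared slice is bounded on every `[t₀,∞)` under the slab bound. [folklore] -/
private theorem smeared_le_of_slab_bound {K : E → ℝ} {n : E} (hn : n ≠ 0)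
    (hslab : ∀ t₀ : ℝ, 0 < t₀ → ∃ M : ℝ, ∀ x : E, t₀ ≤ ⟪x, ‖n‖⁻¹ • n⟫_ℝ → |K x| ≤ M)
    {ι : Type*} [Fintype ι] (y : ι → E) (hy : ∀ a, ⟪y a, n⟫_ℝ = 0) (c : ι → ℝ) :
    ∀ t₀ : ℝ, 0 < t₀ → ∃ M : ℝ, ∀ τ : ℝ, t₀ ≤ τ →
      (∑ a, ∑ b, c a * c b * K (τ • ‖n‖⁻¹ • n + (y a - y b))) ≤ M := by
  intro t₀ ht₀
  obtain ⟨M, hM⟩ := hslab t₀ ht₀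
  have hM0 : 0 ≤ M := by
    have h1 : t₀ ≤ ⟪t₀ • ‖n‖⁻¹ • n, ‖n‖⁻¹ • n⟫_ℝ := by
      rw [real_inner_smul_left, inner_unitNormal_self n hn, mul_one]
    exact (abs_nonneg _).trans (hM _ h1)
  refine ⟨∑ a, ∑ b, |c a| * |c b| * M, fun τ hτ => ?_⟩
  refine Finset.sum_le_sum fun a _ => Finset.sum_le_sum fun b _ => ?_
  have hin : t₀ ≤ ⟪τ • ‖n‖⁻¹ • n + (y a - y b), ‖n‖⁻¹ • n⟫_ℝ := by
    rw [inner_add_left, real_inner_smul_left, inner_unitNormal_self n hn, mul_one, inner_sub_left,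
      real_inner_smul_right, real_inner_smul_right, hy, hy, mul_zero, sub_zero, add_zero]
    exact hτ
  calc c a * c b * K (τ • ‖n‖⁻¹ • n + (y a - y b))
      ≤ |c a * c b * K (τ • ‖n‖⁻¹ • n + (y a - y b))| := le_abs_self _
    _ = |c a| * |c b| * |K (τ • ‖n‖⁻¹ • n + (y a - y b))| := by rw [abs_mul, abs_mul]
    _ ≤ |c a| * |c b| * M := mul_le_mul_of_nonneg_left (hM _ hin) (by positivity)

/-- The smeared slice is continuous on `(0,∞)` when `K` is continuous off the origin. [folklore] -/
private theorem continuousOn_smeared {K : E → ℝ} {n : E} (hn : n ≠ 0) (hK : ContinuousOn K {0}ᶜ)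
    {ι : Type*} [Fintype ι] (y : ι → E) (hy : ∀ a, ⟪y a, n⟫_ℝ = 0) (c : ι → ℝ) :
    ContinuousOn (fun t : ℝ => ∑ a, ∑ b, c a * c b * K (t • ‖n‖⁻¹ • n + (y a - y b))) (Ioi 0) := by
  have hne : ∀ (a b : ι) (t : ℝ), 0 < t → t • ‖n‖⁻¹ • n + (y a - y b) ≠ 0 := by
    intro a b t ht h
    have := congr_arg (fun x => ⟪x, n⟫_ℝ) h
    simp only [inner_add_left, inner_sub_left, real_inner_smul_left, inner_unitNormal_normal n hn, hy,
      sub_zero, add_zero, inner_zero_left] at this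
    exact (mul_pos ht (norm_pos_iff.mpr hn)).ne' this
  refine continuousOn_finsetSum _ fun a _ => continuousOn_finsetSum _ fun b _ => ?_
  have c1 : Continuous (fun t : ℝ => t • ‖n‖⁻¹ • n + (y a - y b)) :=
    (continuous_id.smul continuous_const).add continuous_const
  exact continuousOn_const.mul (hK.comp c1.continuousOn fun t ht => hne a b t ht)

/-! ### Measure form of the slices -/

/-- **Smeared normal slices are Laplace transforms of positive measures.**  For `K` mirror-RP across `n^⊥`, continuous off
`0` and bounded on every closed half-space `{⟪x, n̂⟫ ≥ t₀}` (`t₀ > 0`), every finite transverse configuration `y_a ⊥ n` with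
real weights `c_a` carries ONE positive measure `μ` on `[0,∞)` with
`∑_{a,b} c_a c_b K(t n̂ + (y_a − y_b)) = ∫ e^{-tE} dμ(E)` for all `t > 0` (the integrand `μ`-integrable; `μ` may be infinite).
[cite: GlimmJaffeQP1987, §6.1 Thm. 6.1.3] [cite: Widder1941, Ch. VI Thm. 21] -/
theorem IsMirrorRPKernel.exists_measure_laplace_smeared {K : E → ℝ} {n : E} (hn : n ≠ 0)
    (hK : ContinuousOn K {0}ᶜ)
    (hslab : ∀ t₀ : ℝ, 0 < t₀ → ∃ M : ℝ, ∀ x : E, t₀ ≤ ⟪x, ‖n‖⁻¹ • n⟫_ℝ → |K x| ≤ M)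
    (hRP : IsMirrorRPKernel n K) {ι : Type*} [Fintype ι] (y : ι → E) (hy : ∀ a, ⟪y a, n⟫_ℝ = 0) (c : ι → ℝ) :
    ∃ μ : Measure ℝ, μ (Iio 0) = 0 ∧ ∀ t : ℝ, 0 < t →
      Integrable (fun s => Real.exp (-(t * s))) μ ∧
      ∑ a, ∑ b, c a * c b * K (t • ‖n‖⁻¹ • n + (y a - y b)) = ∫ s, Real.exp (-(t * s)) ∂μ :=
  exists_measure_laplace_eq_of_semigroupPosDef
    (fun t : ℝ => ∑ a, ∑ b, c a * c b * K (t • ‖n‖⁻¹ • n + (y a - y b)))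
    (continuousOn_smeared hn hK y hy c) (hRP.semigroupPosDef_smeared hn y hy c) (smeared_le_of_slab_bound hn hslab y hy c)

/-- **Polarised slices are Laplace transforms of positive measures**: for `K` even, mirror invariant and mirror-RP, `y ⊥ n`
and `ε = ±1`, `K(t n̂) + ε K(t n̂ + y) = ∫ e^{-tE} dμ_ε(E)` (`t > 0`) for a positive measure `μ_ε` on `[0,∞)`.
[cite: GlimmJaffeQP1987, §6.1 Thm. 6.1.3] [cite: Widder1941, Ch. VI Thm. 21] -/
theorem IsMirrorRPKernel.exists_measure_laplace_polarised {K : E → ℝ} {n : E} (hn : n ≠ 0)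
    (hK : ContinuousOn K {0}ᶜ) (heven : ∀ x, K (-x) = K x)
    (hslab : ∀ t₀ : ℝ, 0 < t₀ → ∃ M : ℝ, ∀ x : E, t₀ ≤ ⟪x, ‖n‖⁻¹ • n⟫_ℝ → |K x| ≤ M)
    (hinv : ∀ x, K ((ℝ ∙ n)ᗮ.reflection x) = K x) (hRP : IsMirrorRPKernel n K) {y : E} (hy : ⟪y, n⟫_ℝ = 0)
    {ε : ℝ} (hε : ε = 1 ∨ ε = -1) :
    ∃ μ : Measure ℝ, μ (Iio 0) = 0 ∧ ∀ t : ℝ, 0 < t →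
      Integrable (fun s => Real.exp (-(t * s))) μ ∧
      K (t • ‖n‖⁻¹ • n) + ε * K (t • ‖n‖⁻¹ • n + y) = ∫ s, Real.exp (-(t * s)) ∂μ :=
  exists_measure_laplace_eq_of_semigroupPosDef (fun s : ℝ => K (s • ‖n‖⁻¹ • n) + ε * K (s • ‖n‖⁻¹ • n + y))
    (continuousOn_polarised hn hK hy ε) (hRP.sum_mul_mul_polarised_nonneg hn heven hinv hy hε)
    (polarised_le_of_slab_bound hn hslab hy hε)

/-- **Every normal slice is half the difference of two Laplace transforms of positive measures**: under the hypotheses of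
`IsMirrorRPKernel.exists_halfPlane_continuation` and for `y ⊥ n` there are positive measures `μ₊, μ₋` on `[0,∞)` with
`K(t n̂ + y) = (∫ e^{-tE} dμ₊ − ∫ e^{-tE} dμ₋)/2` and `K(t n̂) = (∫ e^{-tE} dμ₊ + ∫ e^{-tE} dμ₋)/2` for all `t > 0`.
[cite: GlimmJaffeQP1987, §6.1 Thm. 6.1.3] [cite: Widder1941, Ch. VI Thm. 21] -/
theorem IsMirrorRPKernel.exists_measures_laplace_slice {K : E → ℝ} {n : E} (hn : n ≠ 0)
    (hK : ContinuousOn K {0}ᶜ) (heven : ∀ x, K (-x) = K x)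
    (hslab : ∀ t₀ : ℝ, 0 < t₀ → ∃ M : ℝ, ∀ x : E, t₀ ≤ ⟪x, ‖n‖⁻¹ • n⟫_ℝ → |K x| ≤ M)
    (hinv : ∀ x, K ((ℝ ∙ n)ᗮ.reflection x) = K x) (hRP : IsMirrorRPKernel n K) {y : E} (hy : ⟪y, n⟫_ℝ = 0) :
    ∃ μp μm : Measure ℝ, μp (Iio 0) = 0 ∧ μm (Iio 0) = 0 ∧ ∀ t : ℝ, 0 < t →
      Integrable (fun s => Real.exp (-(t * s))) μp ∧ Integrable (fun s => Real.exp (-(t * s))) μm ∧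
      K (t • ‖n‖⁻¹ • n + y) = ((∫ s, Real.exp (-(t * s)) ∂μp) - ∫ s, Real.exp (-(t * s)) ∂μm) / 2 ∧
      K (t • ‖n‖⁻¹ • n) = ((∫ s, Real.exp (-(t * s)) ∂μp) + ∫ s, Real.exp (-(t * s)) ∂μm) / 2 := by
  obtain ⟨μp, hp0, hp⟩ := hRP.exists_measure_laplace_polarised hn hK heven hslab hinv hy (Or.inl rfl)
  obtain ⟨μm, hm0, hm⟩ := hRP.exists_measure_laplace_polarised hn hK heven hslab hinv hy (Or.inr rfl)
  refine ⟨μp, μm, hp0, hm0, fun t ht => ?_⟩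
  obtain ⟨hip, hep⟩ := hp t ht
  obtain ⟨him, hem⟩ := hm t ht
  refine ⟨hip, him, ?_, ?_⟩
  · rw [← hep, ← hem]; ring
  · rw [← hep, ← hem]; ring

/-- **The axis function of a mirror-RP kernel is a Laplace transform of a positive measure**:
`K(t n̂) = ∫ e^{-tE} dμ(E)` for all `t > 0`. [cite: GlimmJaffeQP1987, §6.1 Thm. 6.1.3] [cite: Widder1941, Ch. VI Thm. 21] -/
theorem IsMirrorRPKernel.exists_measure_laplace_axis {K : E → ℝ} {n : E} (hn : n ≠ 0)
    (hK : ContinuousOn K {0}ᶜ)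
    (hslab : ∀ t₀ : ℝ, 0 < t₀ → ∃ M : ℝ, ∀ x : E, t₀ ≤ ⟪x, ‖n‖⁻¹ • n⟫_ℝ → |K x| ≤ M)
    (hRP : IsMirrorRPKernel n K) :
    ∃ μ : Measure ℝ, μ (Iio 0) = 0 ∧ ∀ t : ℝ, 0 < t →
      Integrable (fun s => Real.exp (-(t * s))) μ ∧ K (t • ‖n‖⁻¹ • n) = ∫ s, Real.exp (-(t * s)) ∂μ := by
  -- the smeared slice of the one-point configuration `y = 0`, weight `1`
  obtain ⟨μ, hμ0, hμ⟩ := hRP.exists_measure_laplace_smeared hn hK hslab (ι := Fin 1) (fun _ => (0 : E))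
    (fun _ => by rw [inner_zero_left]) (fun _ => (1 : ℝ))
  refine ⟨μ, hμ0, fun t ht => ⟨(hμ t ht).1, ?_⟩⟩
  have := (hμ t ht).2
  simpa using this

end Literature.MathematicalPhysics.QuantumFieldTheory

end
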